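import Literature.NumberTheory.Automorphic.EichlerEmbeddingLocalLevel
import Literature.NumberTheory.EllipticCurves.HeckeFixedPointCount
import HarnessLib

/-!
# k3 · generation 10 sketch for `stub_takahashi` (crux `stmt-ABC-11338`, `DefiniteRTControlPrime`, route `DefiniteXi`)

FAMILY 3 (probe the extremes), executing gen 9's standing recommendation: **T2 — degenerate parameter `e = 1`**
on the last un-decomposed local node of k3's Plan A, **H6.A1 = the dictionary** between the tree's currency
(`localIdeals / LocalClass / localEmbeddingNumber`, Vignéras III.5.11) and the matrix currency of gens 6–9
(`eichlerSet / IsOptimalMat / EichConj`, Voight §30.6), plus **T3 — perturbation of the proved neighbour**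
(`Brandt.LevelHyp.localEmbeddingNumber_eq`, the tree's level-`q` count) to level `q^e`.

§1  e = 1 ANCHOR: `LevelPowHyp … 1 ↔ Brandt.LevelHyp …` (PROVED) and Voight's Prop. 30.6.12 at `e = 1` ≡ the tree's
    formula (two arithmetic identities H10.2a/b, S), hence H6.A5 at `e = 1` is a COROLLARY of the tree (H10.3, PROVED
    from H10.2a/b) — any proof of H6.A5 for general `e` must specialise to it; conventions (sign of `t`, which term carries
    `[q ∣ d]`) are thereby pinned.  Numerics: scratch/g10_e1_anchor.py, 3125 `(q,t,n)` incl. `q = 2`, 0 mismatches.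
§2  H6.A1 ONE LEVEL DOWN, typed against the real tree API: A1a (membership ↔ `IsOptimalMat`) = H10.5–H10.9,
    A1b (class equality ↔ `EichConj`) = H10.10–H10.11, A1c (surjectivity onto matrix classes) = H10.12,
    A1d (the count as a `Nat.card` of matrix classes) = H10.13; H6.A5 for general `e` is then the kernel-checked
    composition `localEmbeddingNumber_eq_rootCount` of H10.13 (dictionary) + H10.14 (pure matrix count, Voight 30.6.12)
    + H10.15 (disc ≠ 0).  Statements elaborate; proofs are prover work (sizes in the docstrings) except the XS glue
    proved here (H10.1, .3, .4, .5, .7a/b, .11b, .11d, .12b/b′/c, refl/symm/trans, the final composition).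
STATUS (lean check rc 0): 15 sorries, all inside the named helper stubs H10.2a, .2b, .6, .8, .9, .10a, .10, .11a,
.11c, .11, .12a, .12, .13, .14, .15 — zero elsewhere.
Definitions are VERBATIM from gens 6/8/9 (Cruxes/ modules are not built on the farm, so they are inlined).
-/

noncomputable section

open scoped Matrix Pointwise
open Literature.NumberTheory.Automorphic Literature.NumberTheory.Automorphic.Brandt
open Literature.NumberTheory.EllipticCurves.ModularForms (rootCount)

set_option linter.unusedVariables false
set_option linter.dupNamespace false
set_option linter.unusedSectionVars false
set_option linter.unnecessarySimpa false

universe u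

namespace Summit.ABC.ABC.Cruxes.DefiniteRTControlPrime.StubIdeas3g10

/-! ## §0 Definitions (verbatim from gens 6/8/9) -/

section Defs

variable {q : ℕ} [hq : Fact q.Prime]

/-- The standard local Eichler order of level `q^e`, `(ℤ_q ℤ_q; q^e ℤ_q ℤ_q)`, as a set of matrices. -/
def eichlerSet (q : ℕ) [Fact q.Prime] (e : ℕ) : Set (Matrix (Fin 2) (Fin 2) ℚ_[q]) :=
  {A | (∀ i j, ‖A i j‖ ≤ 1) ∧ ‖A 1 0‖ ≤ (q : ℝ) ^ (-(e : ℤ))}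

/-- `A ∈ O` generates an OPTIMALLY embedded order `ℤ_q[A]`: "at least one of `b`, `c/q^e`, `a - d` is a unit". -/
def IsOptimalMat (q : ℕ) [Fact q.Prime] (e : ℕ) (A : Matrix (Fin 2) (Fin 2) ℚ_[q]) : Prop :=
  A ∈ eichlerSet q e ∧
    ¬ (‖A 0 1‖ < 1 ∧ ‖A 0 0 - A 1 1‖ < 1 ∧ ‖A 1 0‖ ≤ (q : ℝ) ^ (-((e + 1 : ℕ) : ℤ)))

/-- Conjugacy under the unit group of the standard Eichler order: `A' = μ⁻¹ A μ`, `μ ∈ O^×`. -/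
def EichConj (q : ℕ) [Fact q.Prime] (e : ℕ) (A A' : Matrix (Fin 2) (Fin 2) ℚ_[q]) : Prop :=
  ∃ μ : Matrix (Fin 2) (Fin 2) ℚ_[q], μ ∈ eichlerSet q e ∧ IsUnit μ.det ∧ μ⁻¹ ∈ eichlerSet q e ∧
    A' = μ⁻¹ * A * μ

/-- `#img({y mod q^{e+1} : y² - ty + n = 0} → ℤ/q^e)` — the second term of Voight Prop. 30.6.12 (gen 6). -/
def liftRootCount (q : ℕ) [Fact q.Prime] (e : ℕ) (t n : ℤ) : ℕ := by
  classical
  exact ((Finset.univ.filter fun y : ZMod (q ^ (e + 1)) =>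
      y ^ 2 - (t : ZMod (q ^ (e + 1))) * y + (n : ZMod (q ^ (e + 1))) = 0).image
    (ZMod.castHom (pow_dvd_pow q (Nat.le_succ e)) (ZMod (q ^ e)))).card

/-- **Hypotheses of the local count at level `q^e`** (gen 6) = the tree's `Brandt.LevelHyp` with `hO` at exponent `e`. -/
structure LevelPowHyp {D : Type u} [Ring D] [Algebra ℚ D] (Φ : D →ₐ[ℚ] Matrix (Fin 2) (Fin 2) ℚ_[q])
    (O : Submodule ℤ D) (γ : D) (B : Submodule ℤ D) (σ₀ : D) (r₀ : ℚ) (m : ℕ) (tB nB : ℤ) (e : ℕ) :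
    Prop where
  hD : ∀ x : D, x ≠ 0 → IsUnit x
  hγ : γ ∉ (⊥ : Subalgebra ℚ D)
  he : 1 ≤ e
  hO : ∀ y : D, y ∈ localAt q O ↔ (∀ i j, ‖Φ y i j‖ ≤ 1) ∧ ‖Φ y 1 0‖ ≤ (q : ℝ) ^ (-(e : ℤ))
  hO1 : (1 : D) ∈ O
  hOmul : ∀ a ∈ O, ∀ b ∈ O, a * b ∈ O
  hB : IsQuadOrder γ B
  hm : m ≠ 0
  hσ₀ : σ₀ = algebraMap ℚ D r₀ + (m : ℚ)⁻¹ • γ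
  hBσ : ∀ b : D, b ∈ B ↔ ∃ u v : ℤ, b = algebraMap ℚ D u + v • σ₀
  hsq : σ₀ * σ₀ = (tB : ℚ) • σ₀ - algebraMap ℚ D nB

end Defs

/-! ## §1 The `e = 1` anchor (T2: degenerate parameter) -/

section Anchor

variable {q : ℕ} [hq : Fact q.Prime]

/-- H10.1 (XS) **`LevelPowHyp` at `e = 1` IS the tree's `Brandt.LevelHyp`** (`q^{-1} = q⁻¹`). PROVED. -/
theorem levelPowHyp_one_iff {D : Type u} [Ring D] [Algebra ℚ D] [IsQuaternionAlgebra ℚ D]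
    (Φ : D →ₐ[ℚ] Matrix (Fin 2) (Fin 2) ℚ_[q]) (O : Submodule ℤ D) (γ : D) (B : Submodule ℤ D)
    (σ₀ : D) (r₀ : ℚ) (m : ℕ) (tB nB : ℤ) :
    LevelPowHyp Φ O γ B σ₀ r₀ m tB nB 1 ↔ Brandt.LevelHyp Φ O γ B σ₀ r₀ m tB nB := by
  have h1 : ((q : ℝ) ^ (-((1 : ℕ) : ℤ))) = (q : ℝ)⁻¹ := by simp
  constructor
  · intro H
    exact { hD := H.hD, hγ := H.hγ, hO := fun y => by rw [H.hO, h1], hO1 := H.hO1, hOmul := H.hOmul,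
            hB := H.hB, hm := H.hm, hσ₀ := H.hσ₀, hBσ := H.hBσ, hsq := H.hsq }
  · intro H
    exact { hD := H.hD, hγ := H.hγ, he := le_rfl, hO := fun y => by rw [H.hO, h1], hO1 := H.hO1,
            hOmul := H.hOmul, hB := H.hB, hm := H.hm, hσ₀ := H.hσ₀, hBσ := H.hBσ, hsq := H.hsq }

/-- H10.2a (S) the first terms agree: roots of `x² - t x + n` in `ℤ/q` ↔ residues `k = -x` with
`q ∣ k² + t k + n` (bijection `x ↦ (-x).val`). -/
theorem rootCount_zmod_eq_card_filter (t n : ℤ) :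
    rootCount (ZMod q) (t : ZMod q) (n : ZMod q) =
      ((Finset.range q).filter fun k : ℕ => (q : ℤ) ∣ (k : ℤ) ^ 2 + t * k + n).card := by
  sorry

/-- H10.2b (S–M) the second terms agree: when `q ∣ d = t² - 4n` all roots mod `q²` reduce to the single
residue `t/2` (resp. `n` at `q = 2`), so `liftRootCount q 1 ≤ 1`, and it is `1` iff some `k = -y` has
`q² ∣ k² + t k + n` — in which case `q ∣ t + 2k` automatically (`(t+2k)² = 4(k²+tk+n) + d`); conversely the
tree's indicator forces `q ∣ d` by the same identity. Numerically certified (3125 cases, `q ≤ 11`, incl. `q = 2`). -/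
theorem ite_liftRootCount_one_eq (t n : ℤ)
    [Decidable (∃ k : ℤ, (q : ℤ) ∣ t + 2 * k ∧ (q : ℤ) ^ 2 ∣ k ^ 2 + t * k + n)] :
    (if (q : ℤ) ∣ t ^ 2 - 4 * n then liftRootCount q 1 t n else 0) =
      if ∃ k : ℤ, (q : ℤ) ∣ t + 2 * k ∧ (q : ℤ) ^ 2 ∣ k ^ 2 + t * k + n then 1 else 0 := by
  sorry

/-- H10.3 **H6.A5 at `e = 1` is a corollary of the tree** (`Brandt.LevelHyp.localEmbeddingNumber_eq` + H10.1 +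
H10.2a/b): Voight's Prop. 30.6.12 in the tree's currency at a prime exactly dividing the level.
PROVED from H10.2a/b (the `q ^ 1` is kept to match H6.A5's shape `ZMod (q ^ e)` literally). -/
theorem localEmbeddingNumber_eq_rootCount_one {D : Type u} [Ring D] [Algebra ℚ D] [IsQuaternionAlgebra ℚ D]
    {Φ : D →ₐ[ℚ] Matrix (Fin 2) (Fin 2) ℚ_[q]} {O : Submodule ℤ D} {γ : D} {B : Submodule ℤ D}
    {σ₀ : D} {r₀ : ℚ} {m : ℕ} {tB nB : ℤ} (H : LevelPowHyp Φ O γ B σ₀ r₀ m tB nB 1) :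
    localEmbeddingNumber O γ B q =
      rootCount (ZMod (q ^ 1)) (tB : ZMod (q ^ 1)) (nB : ZMod (q ^ 1)) +
        (if (q : ℤ) ∣ tB ^ 2 - 4 * nB then liftRootCount q 1 tB nB else 0) := by
  classical
  rw [((levelPowHyp_one_iff Φ O γ B σ₀ r₀ m tB nB).mp H).localEmbeddingNumber_eq,
    ite_liftRootCount_one_eq, show q ^ 1 = q from pow_one q, rootCount_zmod_eq_card_filter]

end Anchor

/-! ## §2 H6.A1 one level down — the dictionary `x O_(q) ↦ A_x = Φ(x)⁻¹ Φ(σ₀) Φ(x)` at level `q^e`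

Tree currency (EichlerEmbeddingLocalGlobal.lean): `localIdeals O γ B q = {L | (∃ x : Dˣ, L = x • O_(q)) ∧
optimalOrder L γ = B_(q)}`, classes `LocalClass` = quotient by `L' = c • L`, `c ∈ Dˣ` commuting with `γ`
(i.e. `c ∈ ℚ(γ)ˣ`, global), `localEmbeddingNumber = Nat.card LocalClass`.  Matrix currency (gens 6–9): optimal
matrices with the characteristic polynomial of `σ₀` modulo `EichConj` (`O^×`-conjugacy, `μ, μ⁻¹ ∈ O`).
The e = 1 anchor (§1) shows the two counts agree at `e = 1` (no index factor `O^×/O^1`, no normaliser twist). -/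

section Dictionary

variable {q : ℕ} [hq : Fact q.Prime] {D : Type u} [Ring D] [Algebra ℚ D] [IsQuaternionAlgebra ℚ D]
  {Φ : D →ₐ[ℚ] Matrix (Fin 2) (Fin 2) ℚ_[q]} {O : Submodule ℤ D} {γ : D} {B : Submodule ℤ D}
  {σ₀ : D} {r₀ : ℚ} {m : ℕ} {tB nB : ℤ} {e : ℕ}

/-- The matrix of the local ideal `x O_(q)`: `A_x = Φ(x⁻¹ σ₀ x)` (the embedding `σ₀ ↦ A_x` of `B_q` into the
STANDARD order `Φ(x)⁻¹ Φ(O_L(x O_q)) Φ(x) = (ℤ_q ℤ_q; q^e ℤ_q ℤ_q)`). -/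
def matOf (Φ : D →ₐ[ℚ] Matrix (Fin 2) (Fin 2) ℚ_[q]) (σ₀ : D) (x : Dˣ) : Matrix (Fin 2) (Fin 2) ℚ_[q] :=
  Φ ((x⁻¹ : Dˣ) : D) * Φ σ₀ * Φ (x : D)

/-- H10.4 (XS) `Φ(x⁻¹ (u + v σ₀) x) = u · 1 + v · A_x`. -/
theorem map_conj_ratCoordsσ (x : Dˣ) (u v : ℚ) :
    Φ (((x⁻¹ : Dˣ) : D) * ((algebraMap ℚ D u + v • σ₀) * (x : D))) =
      (u : ℚ_[q]) • (1 : Matrix (Fin 2) (Fin 2) ℚ_[q]) + (v : ℚ_[q]) • matOf Φ σ₀ x := by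
  have h1 : ((x⁻¹ : Dˣ) : D) * ((algebraMap ℚ D u + v • σ₀) * (x : D)) =
      u • (1 : D) + v • (((x⁻¹ : Dˣ) : D) * σ₀ * (x : D)) := by
    rw [add_mul, mul_add, Algebra.algebraMap_eq_smul_one, smul_mul_assoc, one_mul, mul_smul_comm,
      Units.inv_mul, smul_mul_assoc, mul_smul_comm, mul_assoc]
  rw [h1, map_add, map_smul, map_smul, map_one, map_mul, map_mul, matOf,
    ← algebraMap_smul ℚ_[q] u, ← algebraMap_smul ℚ_[q] v, eq_ratCast, eq_ratCast]

/-- H10.5 (S) **left order in matrix form**: `u + v σ₀ ∈ O_L(x O_(q))` iff `u · 1 + v · A_x ∈ (ℤ_q ℤ_q; q^e ℤ_q ℤ_q)`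
(`mem_leftOrder_smul_localAt_iff` + `hO` + H10.4). PROVED. -/
theorem ratCoordsσ_mem_leftOrder_iff (H : LevelPowHyp Φ O γ B σ₀ r₀ m tB nB e) (x : Dˣ) (u v : ℚ) :
    algebraMap ℚ D u + v • σ₀ ∈ leftOrder (x • localAt q O) ↔
      ((u : ℚ_[q]) • (1 : Matrix (Fin 2) (Fin 2) ℚ_[q]) + (v : ℚ_[q]) • matOf Φ σ₀ x) ∈ eichlerSet q e := by
  rw [mem_leftOrder_smul_localAt_iff H.hO1 H.hOmul, mem_units_smul_submodule_iff, Units.smul_def, smul_eq_mul,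
    H.hO, map_conj_ratCoordsσ]
  rfl

/-- H10.6 (S) **`B_(q)` in coordinates**: `u + v σ₀ ∈ B_(q)` iff `u, v ∈ ℤ_(q)` (tree:
`IsQuadOrder.mem_localAt_iff_of_monogenic H.hBσ`, `rat_coords_unique`, `Padic.norm_ratCast_le_one_iff`). -/
theorem ratCoordsσ_mem_localAt_iff (H : LevelPowHyp Φ O γ B σ₀ r₀ m tB nB e) (u v : ℚ) :
    algebraMap ℚ D u + v • σ₀ ∈ localAt q B ↔ ‖(u : ℚ_[q])‖ ≤ 1 ∧ ‖(v : ℚ_[q])‖ ≤ 1 := by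
  sorry

/-- H10.7a (XS) `u + v σ₀ ∈ ℚ(γ)`. PROVED. -/
theorem ratCoordsσ_mem_adjoin (H : LevelPowHyp Φ O γ B σ₀ r₀ m tB nB e) (u v : ℚ) :
    algebraMap ℚ D u + v • σ₀ ∈ Algebra.adjoin ℚ {γ} := by
  rw [H.hσ₀, ratCoords_monogenic]
  exact ratCoords_mem_adjoin γ _ _

/-- H10.7b (XS) every element of `ℚ(γ)` is `u + v σ₀` (`σ₀ = r₀ + γ/m`, `m ≠ 0`). PROVED. -/
theorem exists_ratCoordsσ_of_mem_adjoin (H : LevelPowHyp Φ O γ B σ₀ r₀ m tB nB e) {y : D}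
    (hy : y ∈ Algebra.adjoin ℚ {γ}) : ∃ u v : ℚ, y = algebraMap ℚ D u + v • σ₀ := by
  obtain ⟨r, s, rfl⟩ := exists_rat_eq_of_mem_adjoin H.hD H.hγ hy
  have hm : (m : ℚ) ≠ 0 := Nat.cast_ne_zero.mpr H.hm
  refine ⟨r - s * m * r₀, s * m, ?_⟩
  rw [H.hσ₀, ratCoords_monogenic]
  congr 2
  · ring
  · field_simp

/-- H10.8 (S–M, pure matrix) **optimality as an integrality test on RATIONAL combinations**:
`A` is optimal iff `A ∈ O` and `u·1 + v·A ∈ O` (`u, v ∈ ℚ`) forces `v ∈ ℤ_q`.  (`⇒`: `‖v‖ ≥ q` makes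
`b`, `a - d` small and `c ≤ q^{-e-1}`; `⇐`: if not optimal, `u = -z/q`, `v = 1/q` with `z ∈ ℕ`, `‖a - z‖ ≤ q⁻¹`
(`exists_nat_norm_sub_le`) gives `(A - z)/q ∈ O`.) -/
theorem isOptimalMat_iff_forall_rat {A : Matrix (Fin 2) (Fin 2) ℚ_[q]} :
    IsOptimalMat q e A ↔ A ∈ eichlerSet q e ∧
      ∀ u v : ℚ, ((u : ℚ_[q]) • (1 : Matrix (Fin 2) (Fin 2) ℚ_[q]) + (v : ℚ_[q]) • A) ∈ eichlerSet q e →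
        ‖(v : ℚ_[q])‖ ≤ 1 := by
  sorry

/-- H10.9 = **H6.A1a** (S given H10.5–H10.8) **membership**: `x O_(q)` has optimal order `B_(q)` iff `A_x` is optimal
in the standard order.  Assembly: `optimalOrder = leftOrder ⊓ ℚ(γ)` (`mem_optimalOrder_iff`), both sides consist of
`u + vσ₀` (H10.7), compare H10.5 with H10.6 for all `u v : ℚ`, and use H10.8 (+ `v ∈ ℤ_q ∧ u·1+v·A ∈ O ⇒ u ∈ ℤ_q`). -/
theorem smul_localAt_mem_localIdeals_iff (H : LevelPowHyp Φ O γ B σ₀ r₀ m tB nB e) (x : Dˣ) :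
    x • localAt q O ∈ localIdeals O γ B q ↔ IsOptimalMat q e (matOf Φ σ₀ x) := by
  sorry

/-- H10.10a (S) **equality of translates**: `x' O_(q) = c x O_(q)` iff `(cx)⁻¹ x' ∈ O_(q)` and `x'⁻¹ c x ∈ O_(q)`
(`O_(q) ∋ 1` multiplicatively closed; `mem_units_smul_submodule_iff`). -/
theorem smul_localAt_eq_smul_iff (H : LevelPowHyp Φ O γ B σ₀ r₀ m tB nB e) (x x' c : Dˣ) :
    x' • localAt q O = c • (x • localAt q O) ↔
      ((x⁻¹ * c⁻¹ * x' : Dˣ) : D) ∈ localAt q O ∧ ((x'⁻¹ * c * x : Dˣ) : D) ∈ localAt q O := by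
  sorry

/-- H10.10 = **H6.A1b (⇒)** (S) equivalent local ideals have `O^×`-CONJUGATE matrices: witness
`μ = Φ(x⁻¹ c⁻¹ x')` (in `O^×` by H10.10a + `hO`; `μ⁻¹ A_x μ = A_{x'}` because `c ∈ ℚ(γ)` commutes with `σ₀`). -/
theorem eichConj_matOf_of_smul_eq (H : LevelPowHyp Φ O γ B σ₀ r₀ m tB nB e) {x x' c : Dˣ}
    (hc : (c : D) * γ = γ * c) (h : x' • localAt q O = c • (x • localAt q O)) :
    EichConj q e (matOf Φ σ₀ x) (matOf Φ σ₀ x') := by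
  sorry

/-- H10.11a (S, linear algebra) the centraliser of a non-scalar `2 × 2` matrix is `F·1 + F·A`. -/
theorem exists_eq_smul_add_smul_of_commute {A κ : Matrix (Fin 2) (Fin 2) ℚ_[q]} (hA : ∀ c : ℚ_[q], A ≠ c • 1)
    (h : κ * A = A * κ) : ∃ α β : ℚ_[q], κ = α • 1 + β • A := by
  sorry

/-- H10.11b (XS, `Padic.rat_dense`) `ℚ²` is dense in `ℚ_q²` (density of `Φ(ℚ(γ))` in `ℚ_q[Φ σ₀]`). PROVED. -/
theorem exists_rat_pair_norm_sub_le (α β : ℚ_[q]) (N : ℕ) :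
    ∃ u v : ℚ, ‖(u : ℚ_[q]) - α‖ ≤ (q : ℝ) ^ (-(N : ℤ)) ∧ ‖(v : ℚ_[q]) - β‖ ≤ (q : ℝ) ^ (-(N : ℤ)) := by
  have hε : (0 : ℝ) < (q : ℝ) ^ (-(N : ℤ)) := zpow_pos (by exact_mod_cast hq.out.pos) _
  obtain ⟨u, hu⟩ := Padic.rat_dense q α hε
  obtain ⟨v, hv⟩ := Padic.rat_dense q β hε
  exact ⟨u, v, by rw [norm_sub_rev]; exact hu.le, by rw [norm_sub_rev]; exact hv.le⟩

/-- H10.11c (S–M) **the stabiliser is open**: matrices `λ ≡ 1 (mod q^N)`, `N = N(g, e)`, conjugate by `g` into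
Eichler UNITS (`g⁻¹ λ g ∈ O`, `(g⁻¹ λ g)⁻¹ = g⁻¹ λ⁻¹ g ∈ O`; `λ⁻¹ = adj λ / det λ ≡ 1`). -/
theorem exists_forall_conj_mem_eichlerSet (g : Matrix (Fin 2) (Fin 2) ℚ_[q]) (hg : IsUnit g.det) (e : ℕ) :
    ∃ N : ℕ, ∀ lam : Matrix (Fin 2) (Fin 2) ℚ_[q], (∀ i j, ‖(lam - 1) i j‖ ≤ (q : ℝ) ^ (-(N : ℤ))) →
      g⁻¹ * lam * g ∈ eichlerSet q e ∧ IsUnit (g⁻¹ * lam * g).det ∧ (g⁻¹ * lam * g)⁻¹ ∈ eichlerSet q e := by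
  sorry

/-- H10.11d (XS; = gen 9 H9.8a, proof copied) `O` is multiplicatively closed (ultrametric inequality entrywise). -/
theorem eichlerSet_mul_mem {e : ℕ} {M N : Matrix (Fin 2) (Fin 2) ℚ_[q]} (hM : M ∈ eichlerSet q e)
    (hN : N ∈ eichlerSet q e) : M * N ∈ eichlerSet q e := by
  have hq0 : (0 : ℝ) < q := by exact_mod_cast hq.out.pos
  have entry : ∀ i j, (M * N) i j = M i 0 * N 0 j + M i 1 * N 1 j := fun i j => by
    simp [Matrix.mul_apply, Fin.sum_univ_two]
  refine ⟨fun i j => ?_, ?_⟩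
  · rw [entry]
    refine (Padic.nonarchimedean _ _).trans (max_le ?_ ?_)
    · rw [norm_mul]; exact mul_le_one₀ (hM.1 i 0) (norm_nonneg _) (hN.1 0 j)
    · rw [norm_mul]; exact mul_le_one₀ (hM.1 i 1) (norm_nonneg _) (hN.1 1 j)
  · rw [entry]
    refine (Padic.nonarchimedean _ _).trans (max_le ?_ ?_)
    · rw [norm_mul]
      calc ‖M 1 0‖ * ‖N 0 0‖ ≤ (q : ℝ) ^ (-(e : ℤ)) * 1 :=
            mul_le_mul hM.2 (hN.1 0 0) (norm_nonneg _) (zpow_nonneg hq0.le _)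
        _ = (q : ℝ) ^ (-(e : ℤ)) := mul_one _
    · rw [norm_mul]
      calc ‖M 1 1‖ * ‖N 1 0‖ ≤ 1 * (q : ℝ) ^ (-(e : ℤ)) :=
            mul_le_mul (hM.1 1 1) hN.2 (norm_nonneg _) zero_le_one
        _ = (q : ℝ) ^ (-(e : ℤ)) := one_mul _

/-- H10.11 = **H6.A1b (⇐)** (M given H10.10a–H10.11d) `O^×`-conjugate matrices come from EQUIVALENT local ideals:
`κ := Φ(x') μ⁻¹ Φ(x)⁻¹` (so `μ = Φ(x)⁻¹ κ⁻¹ Φ(x')`) centralises `Φ σ₀`, hence `κ = α + β Φσ₀` (H10.11a); pick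
`c = u + vσ₀ ∈ ℚ(γ)` with `λ := Φ(c) κ⁻¹ ≡ 1 mod q^N` (H10.11b; `λ, κ, Φ(c)` commute — all lie in `ℚ_q[Φσ₀]`; `c ≠ 0`
hence a unit by `hD`); then `Φ(x⁻¹ c⁻¹ x') = (Φ(x)⁻¹ λ⁻¹ Φ(x))·μ ∈ O` and its inverse `μ⁻¹ (Φ(x)⁻¹ λ Φ(x)) ∈ O`
(H10.11c with `g = Φ(x)`, H10.11d), so `x' O_(q) = c x O_(q)` by H10.10a + `hO`. Template at `e = 1`:
`Brandt.exists_eq_smul_of_pair_eq`. -/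
theorem exists_smul_eq_of_eichConj_matOf (H : LevelPowHyp Φ O γ B σ₀ r₀ m tB nB e) {x x' : Dˣ}
    (h : EichConj q e (matOf Φ σ₀ x) (matOf Φ σ₀ x')) :
    ∃ c : Dˣ, (c : D) * γ = γ * c ∧ x' • localAt q O = c • (x • localAt q O) := by
  sorry

/-- H10.12a (S–M, rational canonical form) two NON-SCALAR `2 × 2` matrices with the same quadratic relation are
`GL₂(ℚ_q)`-conjugate (cyclic vectors, `exists_vdet_mulVec_ne_zero`; both become the companion matrix). -/
theorem exists_conj_eq_of_quadratic {A A' : Matrix (Fin 2) (Fin 2) ℚ_[q]} {t n : ℚ_[q]}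
    (hA : A * A - t • A + n • (1 : Matrix (Fin 2) (Fin 2) ℚ_[q]) = 0)
    (hA' : A' * A' - t • A' + n • (1 : Matrix (Fin 2) (Fin 2) ℚ_[q]) = 0)
    (hAns : ∀ c : ℚ_[q], A ≠ c • 1) (hA'ns : ∀ c : ℚ_[q], A' ≠ c • 1) :
    ∃ g : Matrix (Fin 2) (Fin 2) ℚ_[q], IsUnit g.det ∧ A' = g⁻¹ * A * g := by
  sorry

/-- H10.12b′ (XS) any `s` with `s² = t_B s - n_B` maps to a matrix root of `X² - t_B X + n_B`. PROVED. -/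
theorem map_quadratic_of_sq_eq {s : D} (hs : s * s = (tB : ℚ) • s - algebraMap ℚ D nB) :
    Φ s * Φ s - ((tB : ℚ) : ℚ_[q]) • Φ s + ((nB : ℚ) : ℚ_[q]) • (1 : Matrix (Fin 2) (Fin 2) ℚ_[q]) = 0 := by
  have h := congrArg Φ hs
  rw [map_mul, map_sub, map_smul, AlgHom.commutes, Algebra.algebraMap_eq_smul_one,
    ← algebraMap_smul ℚ_[q] (tB : ℚ), ← algebraMap_smul ℚ_[q] (nB : ℚ) (1 : Matrix (Fin 2) (Fin 2) ℚ_[q]),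
    eq_ratCast, eq_ratCast] at h
  rw [h]; abel

/-- H10.12b (XS) `Φ σ₀` satisfies `X² - t_B X + n_B` (from `hsq`). PROVED. -/
theorem map_σ₀_quadratic (H : LevelPowHyp Φ O γ B σ₀ r₀ m tB nB e) :
    Φ σ₀ * Φ σ₀ - ((tB : ℚ) : ℚ_[q]) • Φ σ₀ + ((nB : ℚ) : ℚ_[q]) • (1 : Matrix (Fin 2) (Fin 2) ℚ_[q]) = 0 :=
  map_quadratic_of_sq_eq H.hsq

/-- H10.12c (XS) the same for every `A_x` (conjugate of `Φ σ₀`: `(x⁻¹σ₀x)² = t_B (x⁻¹σ₀x) - n_B` in `D`). PROVED. -/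
theorem matOf_quadratic (H : LevelPowHyp Φ O γ B σ₀ r₀ m tB nB e) (x : Dˣ) :
    matOf Φ σ₀ x * matOf Φ σ₀ x - ((tB : ℚ) : ℚ_[q]) • matOf Φ σ₀ x +
      ((nB : ℚ) : ℚ_[q]) • (1 : Matrix (Fin 2) (Fin 2) ℚ_[q]) = 0 := by
  have hs : ((x⁻¹ : Dˣ) : D) * σ₀ * (x : D) * (((x⁻¹ : Dˣ) : D) * σ₀ * (x : D)) =
      (tB : ℚ) • (((x⁻¹ : Dˣ) : D) * σ₀ * (x : D)) - algebraMap ℚ D nB := by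
    calc ((x⁻¹ : Dˣ) : D) * σ₀ * (x : D) * (((x⁻¹ : Dˣ) : D) * σ₀ * (x : D))
        = ((x⁻¹ : Dˣ) : D) * (σ₀ * σ₀) * (x : D) := by
          simp only [mul_assoc, Units.mul_inv_cancel_left]
      _ = (tB : ℚ) • (((x⁻¹ : Dˣ) : D) * σ₀ * (x : D)) - algebraMap ℚ D nB := by
          rw [H.hsq]
          simp only [mul_sub, sub_mul, mul_smul_comm, smul_mul_assoc, Algebra.algebraMap_eq_smul_one, mul_one,
            Units.inv_mul]
  have hm : matOf Φ σ₀ x = Φ (((x⁻¹ : Dˣ) : D) * σ₀ * (x : D)) := by rw [matOf, map_mul, map_mul]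
  rw [hm]
  exact map_quadratic_of_sq_eq hs

/-- H10.12 = **H6.A1c** (M given H10.12a–c, H10.11c/d) **every optimal matrix class is hit by a GLOBAL `x ∈ Dˣ`**:
`A = g⁻¹ Φσ₀ g` (H10.12a; `A` non-scalar since optimal, gen 9 H9.0b; `Φσ₀` non-scalar since `σ₀ ∉ ℚ`,
`map_ne_smul_one`), approximate `g` by `Φ(x)` (`AlgHom.exists_norm_sub_le Φ g k`, `x ≠ 0` a unit by `hD`),
`μ := g⁻¹ Φ(x) ≡ 1`, so `A_x = μ⁻¹ A μ` with `μ ∈ O^×` (H10.11c at `g = 1`). Template: `Brandt.exists_units_pair_eq`. -/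
theorem exists_units_eichConj_matOf (H : LevelPowHyp Φ O γ B σ₀ r₀ m tB nB e)
    {A : Matrix (Fin 2) (Fin 2) ℚ_[q]} (hA : IsOptimalMat q e A)
    (hchar : A * A - ((tB : ℚ) : ℚ_[q]) • A + ((nB : ℚ) : ℚ_[q]) • (1 : Matrix (Fin 2) (Fin 2) ℚ_[q]) = 0) :
    ∃ x : Dˣ, EichConj q e A (matOf Φ σ₀ x) := by
  sorry

/-! ### A1d — the count as a cardinality of matrix classes -/

/-- `EichConj` is an equivalence relation (refl/symm XS; trans = gen 9 `EichConj.trans`, proved there). -/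
theorem eichConj_refl (e : ℕ) (A : Matrix (Fin 2) (Fin 2) ℚ_[q]) : EichConj q e A A := by
  refine ⟨1, ⟨fun i j => ?_, ?_⟩, by simp, ?_, by simp⟩
  · rw [Matrix.one_apply]; split_ifs <;> simp
  · have hq0 : (0 : ℝ) < q := by exact_mod_cast hq.out.pos
    exact by simpa using (zpow_pos hq0 _).le
  · rw [inv_one]
    refine ⟨fun i j => ?_, ?_⟩
    · rw [Matrix.one_apply]; split_ifs <;> simp
    · have hq0 : (0 : ℝ) < q := by exact_mod_cast hq.out.pos
      exact by simpa using (zpow_pos hq0 _).le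

theorem eichConj_symm {e : ℕ} {A A' : Matrix (Fin 2) (Fin 2) ℚ_[q]} (h : EichConj q e A A') : EichConj q e A' A := by
  obtain ⟨μ, hμ, hdet, hμ', rfl⟩ := h
  refine ⟨μ⁻¹, hμ', ?_, by rwa [Matrix.nonsing_inv_nonsing_inv _ hdet], ?_⟩
  · rw [Matrix.det_nonsing_inv]; exact hdet.ringInverse
  · rw [Matrix.nonsing_inv_nonsing_inv _ hdet, ← mul_assoc, ← mul_assoc, Matrix.mul_nonsing_inv _ hdet, one_mul,
      mul_assoc, Matrix.mul_nonsing_inv _ hdet, mul_one]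

theorem eichConj_trans {e : ℕ} {A A' A'' : Matrix (Fin 2) (Fin 2) ℚ_[q]} (h : EichConj q e A A')
    (h' : EichConj q e A' A'') : EichConj q e A A'' := by
  obtain ⟨μ₁, h1, d1, i1, e1⟩ := h
  obtain ⟨μ₂, h2, d2, i2, e2⟩ := h'
  refine ⟨μ₁ * μ₂, eichlerSet_mul_mem h1 h2, ?_, ?_, ?_⟩
  · rw [Matrix.det_mul]; exact d1.mul d2
  · rw [Matrix.mul_inv_rev]; exact eichlerSet_mul_mem i2 i1
  · rw [e2, e1, Matrix.mul_inv_rev]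
    simp only [Matrix.mul_assoc]

/-- The optimal matrices of the standard level-`q^e` order with the quadratic relation `X² - tX + n`. -/
def OptMat (q : ℕ) [Fact q.Prime] (e : ℕ) (t n : ℤ) : Type :=
  {A : Matrix (Fin 2) (Fin 2) ℚ_[q] //
    IsOptimalMat q e A ∧ A * A - ((t : ℚ) : ℚ_[q]) • A + ((n : ℚ) : ℚ_[q]) • (1 : Matrix (Fin 2) (Fin 2) ℚ_[q]) = 0}

/-- `O^×`-conjugacy on `OptMat`. -/
def optMatSetoid (q : ℕ) [Fact q.Prime] (e : ℕ) (t n : ℤ) : Setoid (OptMat q e t n) where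
  r A A' := EichConj q e A.1 A'.1
  iseqv := ⟨fun A => eichConj_refl e A.1, fun h => eichConj_symm h, fun h h' => eichConj_trans h h'⟩

/-- H10.13 = **H6.A1d** (S–M given A1a/b/c) **the dictionary as a bijection of class sets**:
`m_q(B) = #(OptMat q e t_B n_B / O^×)` — `Nat.card_congr` for the map `⟦x O_(q)⟧ ↦ ⟦A_x⟧`, well defined and
injective by H10.10/H10.11, into `OptMat` by H10.9/H10.12c, onto by H10.12. -/
theorem localEmbeddingNumber_eq_card_optMat_classes (H : LevelPowHyp Φ O γ B σ₀ r₀ m tB nB e) :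
    localEmbeddingNumber O γ B q = Nat.card (Quotient (optMatSetoid q e tB nB)) := by
  sorry

/-- H10.14 (M; = gen 9 A2 ✓ + gen 8 A3/A4 + the counting of gen 6 H6.A5, now a PURELY LOCAL statement about
matrices, no quaternion algebra in sight) **Voight Prop. 30.6.12 / Hijikata 1974 Thm 2.3**: the number of
`O^×`-classes of optimal matrices with relation `X² - tX + n`, `d = t² - 4n ≠ 0`, in the level-`q^e` order is
`#{x ∈ ℤ/q^e : f(x) = 0} + [q ∣ d] · #im({y ∈ ℤ/q^{e+1} : f(y) = 0} → ℤ/q^e)`.  Certified by gen 8's exact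
`O^×`-conjugacy census (13 670 cases incl. `q = 2`, `e ≤ 8`). [corpus: paper:url-ec4e7f04c233 = Voight §30.6] -/
theorem card_optMat_classes_eq {e : ℕ} (he : 1 ≤ e) (t n : ℤ) (hd : t ^ 2 - 4 * n ≠ 0) :
    Nat.card (Quotient (optMatSetoid q e t n)) =
      rootCount (ZMod (q ^ e)) (t : ZMod (q ^ e)) (n : ZMod (q ^ e)) +
        (if (q : ℤ) ∣ t ^ 2 - 4 * n then liftRootCount q e t n else 0) := by
  sorry

/-- H10.15 (S) the discriminant of `B` is nonzero: `t_B² - 4 n_B = 0` would make `σ₀ - t_B/2` nilpotent in the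
division algebra `D`, i.e. `σ₀ ∈ ℚ`, contradicting `γ ∉ ℚ`. -/
theorem disc_ne_zero (H : LevelPowHyp Φ O γ B σ₀ r₀ m tB nB e) : tB ^ 2 - 4 * nB ≠ 0 := by
  sorry

/-- **H6.A5 (general `e`) ASSEMBLED**: `m_q(B) = rootCount + [q ∣ d]·liftRootCount` from the dictionary (H10.13)
and the local class count (H10.14).  Kernel-checked composition; at `e = 1` it is H10.3 (tree corollary). -/
theorem localEmbeddingNumber_eq_rootCount (H : LevelPowHyp Φ O γ B σ₀ r₀ m tB nB e) :
    localEmbeddingNumber O γ B q =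
      rootCount (ZMod (q ^ e)) (tB : ZMod (q ^ e)) (nB : ZMod (q ^ e)) +
        (if (q : ℤ) ∣ tB ^ 2 - 4 * nB then liftRootCount q e tB nB else 0) := by
  rw [localEmbeddingNumber_eq_card_optMat_classes H, card_optMat_classes_eq H.he tB nB (disc_ne_zero H)]

end Dictionary


end Summit.ABC.ABC.Cruxes.DefiniteRTControlPrime.StubIdeas3g10

end
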